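import Mathlib
import Literature.AlgebraicGeometry.Resolution.MaximalPoints
import Literature.AlgebraicGeometry.Resolution.NonPrincipalLocus
import Literature.AlgebraicGeometry.Dimension.PointDimension
import Literature.AlgebraicGeometry.Motives.BettiCycleClassProofs
import Summits.ResolutionOfSingularities.ResolutionOfSingularities.Theorems.WeightedInvariantELadderOneStage
import Summits.ResolutionOfSingularities.ResolutionOfSingularities.Theorems.WeightedInvariantELadderOneStageInv
import Summits.ResolutionOfSingularities.ResolutionOfSingularities.Theorems.WeightedInvariantELadderOneBase
import Summits.ResolutionOfSingularities.ResolutionOfSingularities.Theorems.WeightedInvariantELadderOneDisjoint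
import Summits.ResolutionOfSingularities.ResolutionOfSingularities.Theorems.WeightedInvariantHomogeneousMinimalPrimes
import Summits.ResolutionOfSingularities.ResolutionOfSingularities.Theorems.WeightedInvariantGradedSimpleOrbitCharts
import Summits.ResolutionOfSingularities.ResolutionOfSingularities.Theorems.WeightedInvariantTorusChartDimension
import HarnessLib

/-!
# Rung `e = 1`: closed orbits from the dimension datum — (I2w) is a consequence of (I0)

Route `ResolutionOfSingularities/WeightedInvariant`, door crux `HypersurfaceCentreConstruction`
(stmt-ResolutionOfSingularities-19897), e-ladder `e = 1` of `res-L1-w43-stub-10` (cell res-hironaka); invariant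
`Stage.Inv' = (I0) ∧ (I1) ∧ (I2w)` (`Theorems/WeightedInvariantELadderOneStageInv.lean`, p513926).  This file
proves that the orbit clause (I2w) FOLLOWS from the dimension datum (I0) for EVERY stage
(`Stage.invOrbit_of_invDim`), so that the successor step `stub_e1_inv_succ` only owes (I0′) and (I1′), and
the base step owes nothing new (`Stage.inv'_of_invDim_of_invReg`).  Chart reading at a maximal singular
point `η` on a unit chart `W a` (`A = Γ(Y, W a)`, `P = 𝔭(η)`):

* `Stage.ker_ideal_le_primeIdealOf` — `𝓘(X)(W a) ≤ 𝔭(η)` for `η ∈ i(X)`;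
  `Stage.isUnit_quotient_primeIdealOf_of_isUnit_app` — a section that is a unit on `X ∩ W a` is a unit
  modulo `𝔭(η)` (`i♯` is surjective on the affine chart; res-type-047's `isUnit_quotient_mk_of_isUnit_map`);
* `Stage.isHomogeneous_primeIdealOf_of_mem_maxSing` — `𝔭(η)` is homogeneous on EVERY chart (a minimal prime
  over the reduced ideal of the singular image, `primeIdealOf_mem_minimalPrimes_of_mem_maxPoints`, p501807);
* `Stage.height_le_of_mem_singImage` — under (I0) every point of the singular image has `dim closure ≤ j`
  (`height (i x) = height x`, `height x + coheight x ≤ dim X = j + 1`, `coheight x ≥ 1` off the generic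
  point); `Stage.ringKrullDim_quotient_primeIdealOf_le` — hence `dim A ⧸ 𝔭(η) ≤ j` on any affine chart
  (`height_eq_ringKrullDim_quotient_primeIdealOf`);
* `Stage.invOrbit_of_invDim` — **(I0) ⇒ (I2w)** by `TorusChartDim.gradedSimple_of_ringKrullDim_le` (p510870);
  `Stage.inv'_of_invDim_of_invReg` — `(I0) ∧ (I1) ⇒ Inv'`.

Nothing here is a claim about Hironaka's problem; AI-written, weaker than expert review.
-/

noncomputable section

set_option linter.dupNamespace false -- mandated namespace of this single-conjunct summit

open CategoryTheory AlgebraicGeometry TopologicalSpace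
open Literature.AlgebraicGeometry.Resolution
open Summit.ResolutionOfSingularities.ResolutionOfSingularities.Theorems

namespace Summit.ResolutionOfSingularities.ResolutionOfSingularities.Theorems.ELadderOne.Stage

variable {k : Type} [Field k] (S : Stage k)

/-! ## Chart reading at a point of the hypersurface -/

/-- Membership in a basic open of an affine chart in terms of the prime of the point. [folklore] -/
theorem mem_basicOpen_iff_not_mem_primeIdealOf {X : Scheme.{0}} {x : X} (U : X.affineOpens)
    (hxU : x ∈ (U : X.Opens)) (g : Γ(X, U)) :
    x ∈ X.basicOpen g ↔ g ∉ (U.2.primeIdealOf ⟨x, hxU⟩).asIdeal := by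
  rw [← PrimeSpectrum.mem_basicOpen, ← U.2.fromSpec_preimage_basicOpen g]
  change _ ↔ U.2.fromSpec (U.2.primeIdealOf ⟨x, hxU⟩) ∈ X.basicOpen g
  rw [U.2.fromSpec_primeIdealOf ⟨x, hxU⟩]

/-- **The ideal of the hypersurface lies in the prime of each of its points**: for `η ∈ i(X)` in the chart
`W a`, `𝓘(X)(W a) = (ker i)(W a) ≤ 𝔭(η)`. [folklore] -/
theorem ker_ideal_le_primeIdealOf (a : S.atlas.ι) {η : S.Y} (hη : η ∈ (S.atlas.W a : S.Y.Opens))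
    (hηX : η ∈ Set.range S.i.base) :
    S.i.ker.ideal (S.atlas.W a) ≤ ((S.atlas.W a).2.primeIdealOf ⟨η, hη⟩).asIdeal := by
  intro g hg
  have hsupp : η ∈ S.i.ker.support := S.i.range_subset_ker_support hηX
  rw [Scheme.IdealSheafData.mem_support_iff_of_mem (U := S.atlas.W a) hη,
    Scheme.mem_zeroLocus_iff] at hsupp
  have h := hsupp g hg
  rw [mem_basicOpen_iff_not_mem_primeIdealOf (S.atlas.W a) hη g, not_not] at h
  exact h

/-- **A section that is a unit on the hypersurface is a unit modulo the prime of each of its points**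
(`i♯ : Γ(Y, W a) → Γ(X, X ∩ W a)` is surjective, its kernel `𝓘(X)(W a)` lies in `𝔭(η)`). [folklore] -/
theorem isUnit_quotient_primeIdealOf_of_isUnit_app (a : S.atlas.ι) {η : S.Y}
    (hη : η ∈ (S.atlas.W a : S.Y.Opens)) (hηX : η ∈ Set.range S.i.base) {s : Γ(S.Y, S.atlas.W a)}
    (hs : IsUnit (S.i.app (S.atlas.W a) s)) :
    IsUnit (Ideal.Quotient.mk ((S.atlas.W a).2.primeIdealOf ⟨η, hη⟩).asIdeal s) := by
  refine isUnit_quotient_mk_of_isUnit_map (S.i.app (S.atlas.W a)).hom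
    (S.i.app_surjective _ (S.atlas.W a).2) ?_ hs
  rw [← Scheme.Hom.ker_apply]
  exact S.ker_ideal_le_primeIdealOf a hη hηX

/-- **Unit charts deliver homogeneous units modulo the prime of every point of the hypersurface, in every
degree of `exponent • ℤʲ`.** [folklore] -/
theorem exists_isUnit_quotient_of_isUnitChart {a : S.atlas.ι} (ha : S.IsUnitChart a) {η : S.Y}
    (hη : η ∈ (S.atlas.W a : S.Y.Opens)) (hηX : η ∈ Set.range S.i.base) (χ : Fin S.j → ℤ) :
    ∃ w ∈ S.atlas.piece a (S.atlas.exponent • χ),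
      IsUnit (Ideal.Quotient.mk ((S.atlas.W a).2.primeIdealOf ⟨η, hη⟩).asIdeal w) := by
  obtain ⟨s, hs, hu⟩ := ha χ
  exact ⟨s, hs, S.isUnit_quotient_primeIdealOf_of_isUnit_app a hη hηX hu⟩

/-! ## The prime of a maximal singular point is homogeneous on every chart -/

/-- `maxSing` in the `maxPoints` vocabulary of `Literature/…/MaximalPoints.lean`. [folklore] -/
theorem mem_maxPoints_of_mem_maxSing {η : S.Y} (hη : η ∈ S.maxSing) :
    η ∈ maxPoints (singImage S.i.ker) :=
  ⟨hη.1, fun z hz hzη => hη.2 z hz (specializes_iff_mem_closure.mp hzη)⟩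

/-- **The prime of a maximal singular point is homogeneous on EVERY chart of the atlas** (unit chart or
not): it is a minimal prime over the reduced ideal of the closed singular image, whose minimal primes are
homogeneous because the hypersurface ideal is (p501807). [folklore] -/
theorem isHomogeneous_primeIdealOf_of_mem_maxSing (a : S.atlas.ι) {η : S.Y} (hηm : η ∈ S.maxSing)
    (hη : η ∈ (S.atlas.W a : S.Y.Opens)) :
    letI := S.atlas.gradedRing a
    (((S.atlas.W a).2.primeIdealOf ⟨η, hη⟩).asIdeal).IsHomogeneous (S.atlas.piece a) := by
  letI := S.atlas.gradedRing a
  let Z : Closeds S.Y := ⟨singImage S.i.ker, isClosed_singSet S.f S.i.ker⟩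
  have hmin : ((S.atlas.W a).2.primeIdealOf ⟨η, hη⟩).asIdeal ∈
      ((Scheme.IdealSheafData.vanishingIdeal Z).ideal (S.atlas.W a)).minimalPrimes := by
    rw [Scheme.IdealSheafData.vanishingIdeal_ideal]
    exact primeIdealOf_mem_minimalPrimes_of_mem_maxPoints (S.atlas.W a).2 Z.2
      (S.mem_maxPoints_of_mem_maxSing hηm) hη
  exact isHomogeneous_of_mem_minimalPrimes_vanishingIdeal_singSet S.f S.i.ker Z rfl (S.atlas.W a)
    (S.atlas.piece a) (S.atlas.isHomogeneous_ker a) hmin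

/-! ## The dimension of the closure of a singular point under (I0) -/

/-- **Under (I0), the closure of a point of the singular image has dimension `≤ j`.**  Write `η = i x`;
`x` is not the generic point of the integral `X` (its local ring is not regular), so `coheight x ≥ 1`;
`height x + coheight x ≤ dim X = j + 1`; and `height (i x) = height x` for the closed immersion `i`.
[folklore] -/
theorem height_le_of_mem_singImage (h0 : S.InvDim) {η : S.Y} (hη : η ∈ singImage S.i.ker) :
    Order.height η ≤ (S.j : ℕ∞) := by
  -- a point of `X` under `η` with non-regular local ring
  obtain ⟨x', hx'η, hx'reg⟩ := hη
  -- transport to `X` along the isomorphism `X ≅ V(ker i)`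
  obtain ⟨x, hx⟩ := S.i.toImage.surjective x'
  have hηx : η = S.i.base x := by
    rw [← hx'η, ← hx]
    exact (toImage_apply_eq_iff S.i x (S.i.base x)).mpr rfl |>.symm ▸ rfl
  have hxreg : ¬ IsRegularLocalRing (S.X.presheaf.stalk x) := by
    intro h
    apply hx'reg
    rw [← hx]
    exact (isRegularLocalRing_stalk_image_iff S.i x).mpr h
  have hxgen : x ≠ genericPoint S.X := ne_genericPoint_of_not_isRegularLocalRing hxreg
  -- `coheight x ≥ 1` and `height x + coheight x ≤ j + 1`
  have hco : (1 : ℕ∞) ≤ Order.coheight x :=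
    Order.one_le_iff_ne_zero.mpr (Order.coheight_ne_zero.mpr (not_isMax_of_ne_genericPoint hxgen))
  have hsum : Order.height x + Order.coheight x ≤ (S.j : ℕ∞) + 1 := by
    have h := coe_height_add_coheight_le_topologicalKrullDim x
    rw [h0] at h
    exact_mod_cast h
  have hhx : Order.height x ≤ (S.j : ℕ∞) := by
    have h2 : Order.height x + 1 ≤ (S.j : ℕ∞) + 1 := (add_le_add le_rfl hco).trans hsum
    exact (WithTop.add_le_add_iff_right WithTop.one_ne_top).mp h2
  rw [hηx, Literature.AlgebraicGeometry.Motives.Scheme.height_base_eq_of_isClosedImmersion S.i x]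
  exact hhx

/-- **Under (I0), the orbit-chart quotient at a point of the singular image has dimension `≤ j`** on every
affine chart containing it (`height = dim Γ(Y, W) ⧸ 𝔭(η)` for `Y` locally of finite type over `k`).
[folklore] -/
theorem ringKrullDim_quotient_primeIdealOf_le (h0 : S.InvDim) (W : S.Y.affineOpens) {η : S.Y}
    (hη : η ∈ singImage S.i.ker) (hηW : η ∈ (W : S.Y.Opens)) :
    ringKrullDim (Γ(S.Y, W) ⧸ (W.2.primeIdealOf ⟨η, hηW⟩).asIdeal) ≤ (S.j : WithBot ℕ∞) := by
  rw [← Literature.AlgebraicGeometry.Dimension.Scheme.height_eq_ringKrullDim_quotient_primeIdealOf S.f W.2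
    hηW]
  exact_mod_cast S.height_le_of_mem_singImage h0 hη

/-! ## (I2w) from (I0) -/

/-- **(I0) ⇒ (I2w): on a unit chart through a maximal singular point its prime is homogeneous with
GRADED-SIMPLE quotient.**  Homogeneity: `isHomogeneous_primeIdealOf_of_mem_maxSing`; graded-simplicity:
the chart carries homogeneous units modulo `𝔭(η)` in every degree `exponent • χ`
(`exists_isUnit_quotient_of_isUnitChart`) and `dim Γ(Y, W a) ⧸ 𝔭(η) ≤ j`
(`ringKrullDim_quotient_primeIdealOf_le`), so `TorusChartDim.gradedSimple_of_ringKrullDim_le` (p510870)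
applies. [folklore] -/
theorem invOrbit_of_invDim (h0 : S.InvDim) : S.InvOrbit := by
  intro a ha η hηm hη
  letI := S.atlas.gradedRing a
  have hηX : η ∈ Set.range S.i.base := mem_range_of_mem_singImage S hηm.1
  haveI : (((S.atlas.W a).2.primeIdealOf ⟨η, hη⟩).asIdeal).IsPrime :=
    ((S.atlas.W a).2.primeIdealOf ⟨η, hη⟩).2
  have hhom := S.isHomogeneous_primeIdealOf_of_mem_maxSing a hηm hη
  refine ⟨hhom, ?_⟩
  have hgs := TorusChartDim.gradedSimple_of_ringKrullDim_le (S.atlas.piece a)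
    ((S.atlas.W a).2.primeIdealOf ⟨η, hη⟩).asIdeal hhom (Nat.pos_iff_ne_zero.mp S.atlas.exponent_pos)
    (fun χ => S.exists_isUnit_quotient_of_isUnitChart ha hη hηX χ)
    (S.ringKrullDim_quotient_primeIdealOf_le h0 (S.atlas.W a) hηm.1 hη)
  exact fun d x hx hxP => hgs d hx hxP

/-- **`Inv'` from (I0) and (I1) alone.** [folklore] -/
theorem inv'_of_invDim_of_invReg (h0 : S.InvDim) (h1 : S.InvReg) : S.Inv' :=
  ⟨h0, h1, S.invOrbit_of_invDim h0⟩

end Summit.ResolutionOfSingularities.ResolutionOfSingularities.Theorems.ELadderOne.Stage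

end
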